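/-
Copyright (c) 2026 the pub-hodgecm-mathlib formalisation cell (harness21).  Prover seat hodgecm-mathlib-F0P3-p01 (g31), «(D-RAM) FOUR-FRAME» road of crux H413, line LH4, MS ROAD A,
STAGE B ∕ B5₂ (iv)₂: «GLUED TORUS ORBITS AND THE (R)-LATTICE COUNT AT A GENERAL CORNER» (type-0 and type-2 glued strata at once).  2026-09-04.
-/
import Summits.HodgeConjecture.HodgeConjecture.Theorems.F0P3cDyRamDiagonalGluedStabiliserIndexFullCorner   -- ★ p856198 (this seat): `ncard_unitTorus_orbit_latt_glued_corner_eq`; brings ★ IndexCorner, ★ IndexFull, ★ (O1)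
import Summits.HodgeConjecture.HodgeConjecture.Theorems.F0P3cDyRamDiagonalGluedTorusOrbits                  -- ★ p855894 (LH4-p08 (g2)): `exists_gl_coe_eq_glued`, `latt_glued_kappa_eq_mapGL`, `exists_glued_of_mem_orbit`; brings ★ `latt_hnf_eq_latt_hnf_iff`
import Summits.HodgeConjecture.HodgeConjecture.Theorems.F0P3cDyRamDiagonalGluedClassRepresentatives         -- ★ p855991 (LH4-p08 (g2)): (iv-c) `exists_fixed_class_representatives`
import HarnessLib

/-!
# Crux `H413`, MS ROAD A, STAGE B ∕ B5₂ (iv)₂: the glued lattices satisfying (R), counted by torus orbits — general corner `2ρ + s + e`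

Cell `hodgecm-mathlib` (D-0151), FLOOR 0, crux item H413 = `stmt-HodgeConjecture-24833`; lane `--supports stmt-HodgeConjecture-24833 --as helper` (count-neutral).  THEOREMS ONLY
(no `def`, no instance, no notation, no `sorry`).  The general-corner twin of LH4-p08 (g2)'s ★ (iv-a) p855894 `F0P3cDyRamDiagonalGluedTorusOrbits` + ★ (iv) p856104
`F0P3cDyRamDiagonalGluedBoxCount` (corner `2ρ + 2t`), for the frame `V(x, ζ, y″) = (1 0 0; x ϖ^ρ 0; xζ+y″ ϖ^ρζ ϖ^{2ρ+s+e})`, `|x| = |ζ| = 1`, `|y″| = |ϖ|^s`, `ρ ≥ 1`, any `e`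
(`e = 1`, `s = 2t`: the TYPE-2 glued stratum `G₁(2ρ+1, 2t)` of LH4-p10 (g2) MEMO v2.1 §T2.3, criterion (R) `∃ f = σf, |ζσy″ − σx·f| ≤ |ϖ|^{ρ+s}` by LH4-p09 (g2)'s (i)₂).

THE MATHEMATICS.  §1 `κ := y″∕(xζ)` (`|κ| = |ϖ|^s`) is a lattice invariant MODULO `𝔭^{ρ+s}` at EVERY corner (★ `latt_hnf_eq_latt_hnf_iff`: the `x`-variation term `y″(x−x₁)ζ` has
valuation `ρ + s` — so the class level does NOT follow the corner).  §2 the `x`-REPRESENTATIVE: if `|κ − f| ≤ |ϖ|^{ρ+s}` and `|f| = |ϖ|^s`, then with `x′ := y″∕(fζ)` (a unit,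
`|x − x′| = |κ − f|∕|f| ≤ |ϖ|^ρ`) one has `latt V(x, ζ, y″) = latt V(x′, ζ, f·x′ζ)` EXACTLY (the third HNF congruence vanishes identically), whence by ★ (iv-a)
`latt_glued_kappa_eq_mapGL` every lattice of the class `κ ≡ f` lies in the orbit `𝒯·latt V(1,1,f)`, and conversely (★ `exists_glued_of_mem_orbit`) — this replaces ★ (iv-a)'s
`ζ`-representative, which needs the class level to equal `c − ρ`.  §3 (R) in `κ`-currency (pure `σ`-algebra, any bound).  §4 THE COUNT: with ★ (iv-c)'s `(q−1)q^{⌈ρ∕2⌉−1}`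
fixed class representatives (`s = 2t`) and the orbit size `((q−1)q^{ρ+2t+e−1})((q−1)q^{2ρ+e−1})` (★ p856198):
**`#{latt V(x,ζ,y″) : (R)} = (q−1)³ · q^{3ρ + ⌈ρ∕2⌉ + 2t + 2e − 3}`** (`e = 0`: ★ p856104's value; `e = 1`: `(q−1)³q^{3ρ+⌈ρ∕2⌉+2t−1}`, the type-2 letters `…_typeTwo_eq`).
HONEST LABEL.  Count-neutral (`--supports`); the census laws (MS) stay PROVER TARGETS until the Stage B ∕ B9 assemblies land; `HC_CM` is proved only modulo the 7 printed citations
(2 remaining named inputs: hLiu418 = `stmt-HodgeConjecture-24832`, h413 = `stmt-HodgeConjecture-24833`) until rung 0 closes.  NOTE (memo `F0/P3/F0P3-p01/g31/MEMO-typeTwo-glued-n2-parity.v1`):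
this count × ★ p856076's type-2 weight is `(q−1)q^{2ρ+t−1−[ρ even]}`·… — the per-lattice number of polarisation cosets `n₂` must multiply it for even `ρ`.

## References
* [Kottwitz1986BaseChangeUnits] R. E. Kottwitz, *Base change for unit elements of Hecke algebras*, Compositio Math. 60 (1986), §1 pp. 240–241 (lattice counts via torus orbits).
* [Serre1979] J.-P. Serre, *Local Fields*, GTM 67 (1979), Ch. IV §2 Prop. 6 (unit filtration indices).
* [Serre1980Trees] J.-P. Serre, *Trees*, Springer (1980), Ch. II §1.1 (lattices `g·𝒪^N`, Hermite normal forms).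
-/

set_option autoImplicit false

noncomputable section

namespace Summit.HodgeConjecture.HodgeConjecture.Cruxes.H413.F0P3cDyRamDiagonalGluedBoxCountCorner

open Matrix
open Literature.NumberTheory.Automorphic Literature.NumberTheory.Automorphic.HermitianLattice
open Literature.NumberTheory.Automorphic.UnitaryLatticeTree
open Summit.HodgeConjecture.HodgeConjecture.Cruxes.H413.F0P3cDyRamDiagonalTorusDefs
open Summit.HodgeConjecture.HodgeConjecture.Cruxes.H413.F0P3cDyRamDiagonalStableLatticeHNFExists (latt_hnf_eq_latt_hnf_iff)
open Summit.HodgeConjecture.HodgeConjecture.Cruxes.H413.F0P3cDyRamDiagonalGluedTorusOrbits (exists_gl_coe_eq_glued latt_glued_kappa_eq_mapGL exists_glued_of_mem_orbit)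
open Summit.HodgeConjecture.HodgeConjecture.Cruxes.H413.F0P3cDyRamDiagonalGluedStabiliserIndex (ne_zero_and_v_lt_one_of_v_eq_exp)
open Summit.HodgeConjecture.HodgeConjecture.Cruxes.H413.F0P3cDyRamDiagonalGluedStabiliserIndexFullCorner (ncard_unitTorus_orbit_latt_glued_corner_eq)
open Summit.HodgeConjecture.HodgeConjecture.Cruxes.H413.F0P3cDyRamDiagonalGluedClassRepresentatives (exists_fixed_class_representatives)
open scoped Valued WithZero Matrix MatrixGroups

variable {K : Type*} [Field K] [Valued K ℤᵐ⁰]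

/-! ## §1  `κ = y″∕(xζ)` is a lattice invariant modulo `𝔭^{ρ+s}` at every corner -/

/-- **`κ` IS A LATTICE INVARIANT modulo `𝔭^{ρ+s}`, general corner**: if two glued data `(x, ζ, y″)`, `(x₁, ζ₁, y₁)` (units `x, ζ, x₁, ζ₁`, `|y″| = |ϖ|^s`) give the same lattice
at corner `2ρ+s+e`, then `|y″∕(xζ) − y₁∕(x₁ζ₁)| ≤ |ϖ|^{ρ+s}` (★ `latt_hnf_eq_latt_hnf_iff`: `a := x − x₁ ∈ 𝔭^ρ`, `c := ζ − ζ₁ ∈ 𝔭^{ρ+s+e}`, `E := y″ − y₁ + xc ∈ 𝔭^{2ρ+s+e}`;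
`y″x₁ζ₁ − y₁xζ = y″(−xc − aζ + ac) − x²ζc + E·xζ`). [cite: Kottwitz1986BaseChangeUnits, §1 pp. 240–241] [cite: Serre1980Trees, II §1.1] -/
theorem v_kappa_sub_le_of_latt_glued_corner_eq {ϖ : K} (hϖ : ϖ ≠ 0) (hϖ1 : Valued.v ϖ ≤ 1) (ρ s e : ℕ) {x ζ y'' x₁ ζ₁ y₁ : K}
    (hx : Valued.v x = 1) (hζ : Valued.v ζ = 1) (hy'' : Valued.v y'' = Valued.v ϖ ^ s) (hx₁ : Valued.v x₁ = 1) (hζ₁ : Valued.v ζ₁ = 1)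
    (h : latt (!![1, 0, 0; x, ϖ ^ ρ, 0; x * ζ + y'', ϖ ^ ρ * ζ, ϖ ^ (2 * ρ + s + e)] : Matrix (Fin 3) (Fin 3) K) =
      latt (!![1, 0, 0; x₁, ϖ ^ ρ, 0; x₁ * ζ₁ + y₁, ϖ ^ ρ * ζ₁, ϖ ^ (2 * ρ + s + e)] : Matrix (Fin 3) (Fin 3) K)) :
    Valued.v (y'' / (x * ζ) - y₁ / (x₁ * ζ₁)) ≤ Valued.v ϖ ^ (ρ + s) := by
  have hpρ : ϖ ^ ρ ≠ 0 := pow_ne_zero ρ hϖ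
  have hpr : ϖ ^ (2 * ρ + s + e) ≠ 0 := pow_ne_zero _ hϖ
  have hvρ : (0 : ℤᵐ⁰) < Valued.v ϖ ^ ρ := pow_pos ((Valuation.pos_iff _).2 hϖ) ρ
  have hq1 : ∀ n : ℕ, Valued.v ϖ ^ n ≤ 1 := fun n => pow_le_one₀ zero_le hϖ1
  obtain ⟨ha, hc, he⟩ := (latt_hnf_eq_latt_hnf_iff x (x * ζ + y'') (ϖ ^ ρ * ζ) x₁ (x₁ * ζ₁ + y₁) (ϖ ^ ρ * ζ₁) hpρ hpr).1 h
  rw [map_pow] at ha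
  -- `|ζ − ζ₁| ≤ |ϖ|^(ρ + s + e) ≤ |ϖ|^(ρ + s)`
  have hc' : Valued.v (ζ - ζ₁) ≤ Valued.v ϖ ^ (ρ + s + e) := by
    rw [← mul_sub, map_mul, map_pow, map_pow, show 2 * ρ + s + e = ρ + (ρ + s + e) by ring, pow_add] at hc
    exact (mul_le_mul_iff_right₀ hvρ).1 hc
  have hcs : Valued.v (ζ - ζ₁) ≤ Valued.v ϖ ^ (ρ + s) := hc'.trans (pow_le_pow_right_of_le_one' hϖ1 (by omega))
  -- `|E| ≤ |ϖ|^(2ρ + s + e)`, `E = y″ − y₁ + x(ζ − ζ₁)`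
  have he' : Valued.v (y'' - y₁ + x * (ζ - ζ₁)) ≤ Valued.v ϖ ^ (2 * ρ + s + e) := by
    have hE : (x * ζ + y'' - (x₁ * ζ₁ + y₁)) * ϖ ^ ρ - ϖ ^ ρ * ζ₁ * (x - x₁) = ϖ ^ ρ * (y'' - y₁ + x * (ζ - ζ₁)) := by ring
    rw [hE, map_mul, map_mul, map_pow, map_pow] at he
    exact (mul_le_mul_iff_right₀ hvρ).1 he
  -- the difference of the two `κ`'s
  have hx0 : x ≠ 0 := fun h0 => by rw [h0, map_zero] at hx; exact zero_ne_one hx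
  have hζ0 : ζ ≠ 0 := fun h0 => by rw [h0, map_zero] at hζ; exact zero_ne_one hζ
  have hx0' : x₁ ≠ 0 := fun h0 => by rw [h0, map_zero] at hx₁; exact zero_ne_one hx₁
  have hζ0' : ζ₁ ≠ 0 := fun h0 => by rw [h0, map_zero] at hζ₁; exact zero_ne_one hζ₁
  have key : y'' / (x * ζ) - y₁ / (x₁ * ζ₁) =
      (y'' * (-(x * (ζ - ζ₁)) - (x - x₁) * ζ + (x - x₁) * (ζ - ζ₁)) - x * x * ζ * (ζ - ζ₁) + (y'' - y₁ + x * (ζ - ζ₁)) * (x * ζ)) / (x * ζ * (x₁ * ζ₁)) := by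
    rw [div_sub_div _ _ (mul_ne_zero hx0 hζ0) (mul_ne_zero hx0' hζ0')]
    congr 1
    ring
  have hden : Valued.v (x * ζ * (x₁ * ζ₁)) = 1 := by rw [map_mul, map_mul, map_mul, hx, hζ, hx₁, hζ₁]; simp
  rw [key, map_div₀, hden, div_one]
  have hρle : Valued.v ϖ ^ (ρ + s) ≤ Valued.v ϖ ^ ρ := pow_le_pow_right_of_le_one' hϖ1 (by omega)
  refine Valuation.map_add_le _ (Valuation.map_sub_le _ ?_ ?_) ?_
  · -- `y″·(−xc − aζ + ac)`
    rw [map_mul, hy'', show ρ + s = s + ρ by ring, pow_add]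
    refine mul_le_mul' le_rfl (Valuation.map_add_le _ (Valuation.map_sub_le _ ?_ ?_) ?_)
    · rw [Valuation.map_neg, map_mul, hx, one_mul]; exact hcs.trans hρle
    · rw [map_mul, hζ, mul_one]; exact ha
    · rw [map_mul]; exact le_trans (mul_le_of_le_one_right' (hcs.trans (hq1 _))) ha
  · -- `x²ζ·c`
    simpa [map_mul, hx, hζ] using hcs
  · -- `E·xζ`
    rw [map_mul, map_mul, hx, hζ, mul_one, mul_one]
    exact he'.trans (pow_le_pow_right_of_le_one' hϖ1 (by omega))

/-! ## §2  The `x`-representative with `κ = f` exactly; the orbit of `latt V(1, 1, f)` -/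

/-- **THE `x`-REPRESENTATIVE**: if `|y″∕(xζ) − f| ≤ |ϖ|^{ρ+s}` and `|f| = |ϖ|^s` (`x, ζ` units, `|y″| = |ϖ|^s`), then with `x′ := y″∕(fζ)`:
`latt V(x, ζ, y″) = latt V(x′, ζ, f·x′ζ)` at ANY corner `r` (same `ζ`; `|x − x′| ≤ |ϖ|^ρ`; the third HNF congruence is identically `0`; no hypothesis on `|y″|`). [cite: Serre1980Trees, II §1.1] -/
theorem latt_glued_eq_latt_glued_xrep {ϖ : K} (hϖ : ϖ ≠ 0) (ρ s : ℕ) {x ζ y'' f : K} (hx : Valued.v x = 1) (hζ : Valued.v ζ = 1)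
    (hf : Valued.v f = Valued.v ϖ ^ s) (hκ : Valued.v (y'' / (x * ζ) - f) ≤ Valued.v ϖ ^ (ρ + s)) {r : K} (hr : r ≠ 0) :
    latt (!![1, 0, 0; x, ϖ ^ ρ, 0; x * ζ + y'', ϖ ^ ρ * ζ, r] : Matrix (Fin 3) (Fin 3) K) =
      latt (!![1, 0, 0; y'' / (f * ζ), ϖ ^ ρ, 0; y'' / (f * ζ) * ζ + f * (y'' / (f * ζ) * ζ), ϖ ^ ρ * ζ, r] : Matrix (Fin 3) (Fin 3) K) := by
  have hpρ : ϖ ^ ρ ≠ 0 := pow_ne_zero ρ hϖ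
  have hvϖ : 0 < Valued.v ϖ := (Valuation.pos_iff _).2 hϖ
  have hx0 : x ≠ 0 := fun h0 => by rw [h0, map_zero] at hx; exact zero_ne_one hx
  have hζ0 : ζ ≠ 0 := fun h0 => by rw [h0, map_zero] at hζ; exact zero_ne_one hζ
  have hf0 : f ≠ 0 := fun h0 => by rw [h0, map_zero] at hf; exact pow_ne_zero _ hvϖ.ne' hf.symm
  rw [latt_hnf_eq_latt_hnf_iff _ _ _ _ _ _ hpρ hr]
  refine ⟨?_, by rw [sub_self, map_zero]; exact zero_le, ?_⟩
  · -- `x − x′ = −x·(κ − f)∕f`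
    have e1 : x - y'' / (f * ζ) = -(x * (y'' / (x * ζ) - f) / f) := by field_simp; ring
    rw [e1, Valuation.map_neg, map_div₀, map_mul, hx, one_mul, hf, map_pow, div_le_iff₀ (pow_pos hvϖ _), ← pow_add]
    exact hκ
  · have e2 : (x * ζ + y'' - (y'' / (f * ζ) * ζ + f * (y'' / (f * ζ) * ζ))) * ϖ ^ ρ - ϖ ^ ρ * ζ * (x - y'' / (f * ζ)) = 0 := by
      field_simp
      ring
    rw [e2, map_zero]
    exact zero_le

/-- **EVERY GLUED LATTICE OF THE CLASS `κ ≡ f (mod 𝔭^{ρ+s})` LIES IN THE ORBIT `𝒯·latt V(1, 1, f)`**, at any corner `r` (`|f| = |ϖ|^s`; the `x`-representative + ★ (iv-a)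
`latt_glued_kappa_eq_mapGL`). [cite: Kottwitz1986BaseChangeUnits, §1 pp. 240–241] [cite: Serre1980Trees, II §1.1] -/
theorem exists_mem_unitTorus_latt_glued_corner_eq_mapGL {ϖ : K} (hϖ : ϖ ≠ 0) (ρ s : ℕ) {x ζ y'' f : K} (hx : Valued.v x = 1) (hζ : Valued.v ζ = 1)
    (hy'' : Valued.v y'' = Valued.v ϖ ^ s) (hf : Valued.v f = Valued.v ϖ ^ s) (hκ : Valued.v (y'' / (x * ζ) - f) ≤ Valued.v ϖ ^ (ρ + s))
    {r : K} (hr : r ≠ 0) (V₀ : GL (Fin 3) K) (hV₀ : (V₀ : Matrix (Fin 3) (Fin 3) K) = !![1, 0, 0; 1, ϖ ^ ρ, 0; 1 * 1 + f, ϖ ^ ρ * 1, r]) :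
    ∃ u ∈ unitTorus K 3,
      latt (!![1, 0, 0; x, ϖ ^ ρ, 0; x * ζ + y'', ϖ ^ ρ * ζ, r] : Matrix (Fin 3) (Fin 3) K) = mapGL (diagGLUnits u) (latt (V₀ : Matrix (Fin 3) (Fin 3) K)) := by
  have hvϖ : 0 < Valued.v ϖ := (Valuation.pos_iff _).2 hϖ
  have hx' : Valued.v (y'' / (f * ζ)) = 1 := by
    rw [map_div₀, map_mul, hy'', hf, hζ, mul_one, div_self (pow_ne_zero _ hvϖ.ne')]
  obtain ⟨u, hu, h⟩ := latt_glued_kappa_eq_mapGL hx' hζ f (ϖ ^ ρ) r V₀ hV₀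
  exact ⟨u, hu, (latt_glued_eq_latt_glued_xrep hϖ ρ s hx hζ hf hκ hr).trans h⟩

/-! ## §3  (R) in `κ`-currency -/

/-- **(R) ⟺ THE CLASS OF `κ` IS `F`-RATIONAL** (any bound `B`; `σ` an involution with `v ∘ σ = v`, `x ζ` units): `(∃ f = σf, |ζσy″ − σx·f| ≤ B) ↔ (∃ f = σf, |y″∕(xζ) − f| ≤ B)`
(`f ↦ f∕(ζσζ)`, `f ↦ f·ζσζ`). [cite: Kottwitz1986BaseChangeUnits, §1 pp. 240–241] -/
theorem criterionR_iff_exists_fixed_kappa {σ : K →+* K} (hσ : ∀ a, σ (σ a) = a) (hvσ : ∀ a, Valued.v (σ a) = Valued.v a)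
    {x ζ : K} (hx : Valued.v x = 1) (hζ : Valued.v ζ = 1) (y'' : K) (B : ℤᵐ⁰) :
    (∃ f : K, σ f = f ∧ Valued.v (ζ * σ y'' - σ x * f) ≤ B) ↔ ∃ f : K, σ f = f ∧ Valued.v (y'' / (x * ζ) - f) ≤ B := by
  have hx0 : x ≠ 0 := fun h0 => by rw [h0, map_zero] at hx; exact zero_ne_one hx
  have hζ0 : ζ ≠ 0 := fun h0 => by rw [h0, map_zero] at hζ; exact zero_ne_one hζ
  have hσζ0 : σ ζ ≠ 0 := fun h0 => hζ0 (by rw [← hσ ζ, h0, map_zero])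
  have hσζ : Valued.v (σ ζ) = 1 := by rw [hvσ, hζ]
  have hN : σ (ζ * σ ζ) = ζ * σ ζ := by rw [map_mul, hσ, mul_comm]
  constructor
  · rintro ⟨f, hf, hR⟩
    refine ⟨f / (ζ * σ ζ), by rw [map_div₀, hf, hN], ?_⟩
    have hid : y'' / (x * ζ) - f / (ζ * σ ζ) = σ (ζ * σ y'' - σ x * f) / (x * ζ * σ ζ) := by
      rw [map_sub, map_mul, map_mul, hσ, hσ, hf]
      field_simp
    rw [hid, map_div₀, hvσ, map_mul, map_mul, hx, hζ, hσζ, one_mul, one_mul, div_one]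
    exact hR
  · rintro ⟨f, hf, hκ⟩
    refine ⟨f * (ζ * σ ζ), by rw [map_mul, hf, hN], ?_⟩
    have hid : ζ * σ y'' - σ x * (f * (ζ * σ ζ)) = σ (x * ζ * σ ζ * (y'' / (x * ζ) - f)) := by
      rw [map_mul, map_sub, map_mul, map_mul, hσ, hf, map_div₀, map_mul]
      have hσx0 : σ x ≠ 0 := fun h0 => hx0 (by rw [← hσ x, h0, map_zero])
      field_simp
    rw [hid, hvσ, map_mul, map_mul, map_mul, hx, hζ, hσζ, one_mul, one_mul, one_mul]
    exact hκ

/-! ## §4  HEAD — the count of the (R)-lattices of a glued stratum at a general corner -/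

/-- **B5₂ (iv)₂ «GLUED (R)-LATTICE COUNT AT A GENERAL CORNER».**  For a ramified quadratic datum (`σ` involution, `v ∘ σ = v`, fixed elements of even valuation, `|ϖ| = exp(−1)`,
`|ϖ − σϖ| = |ϖ|^d`, finite residue field), `ρ ≥ 1`, `t, e : ℕ`: the glued lattices `latt (1 0 0; x ϖ^ρ 0; xζ+y″ ϖ^ρζ ϖ^{2ρ+2t+e})` (`|x| = |ζ| = 1`, `|y″| = |ϖ|^{2t}`) satisfying
(R) `∃ f = σf, |ζσy″ − σx·f| ≤ |ϖ|^{ρ+2t}` number `(q−1)³ · q^{3ρ + (ρ+1)∕2 + 2t + 2e − 3}` (= ★ (iv-c) `(q−1)q^{(ρ+1)∕2−1}` classes × ★ p856198 orbit size).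
[cite: Kottwitz1986BaseChangeUnits, §1 pp. 240–241] [cite: Serre1979, Ch. IV §2 Prop. 6] -/
theorem ncard_criterionR_glued_corner_eq {σ : K →+* K} {ϖ : K} {d : ℕ} (hσ : ∀ x, σ (σ x) = x) (hvσ : ∀ a, Valued.v (σ a) = Valued.v a)
    (hfix : ∀ x : K, σ x = x → x ≠ 0 → ∃ n : ℤ, Valued.v x = WithZero.exp (2 * n)) (hϖ : Valued.v ϖ = WithZero.exp (-1 : ℤ))
    (hd : Valued.v (ϖ - σ ϖ) = Valued.v ϖ ^ d) [Finite 𝓀[K]] (ρ t e : ℕ) (hρ : 1 ≤ ρ) :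
    {M : Submodule 𝒪[K] (Fin 3 → K) | ∃ x ζ y'' : K, Valued.v x = 1 ∧ Valued.v ζ = 1 ∧ Valued.v y'' = Valued.v ϖ ^ (2 * t) ∧
        M = latt (!![1, 0, 0; x, ϖ ^ ρ, 0; x * ζ + y'', ϖ ^ ρ * ζ, ϖ ^ (2 * ρ + 2 * t + e)] : Matrix (Fin 3) (Fin 3) K) ∧
        ∃ f : K, σ f = f ∧ Valued.v (ζ * σ y'' - σ x * f) ≤ Valued.v ϖ ^ (ρ + 2 * t)}.ncard =
      (Nat.card 𝓀[K] - 1) ^ 3 * Nat.card 𝓀[K] ^ (3 * ρ + (ρ + 1) / 2 + 2 * t + 2 * e - 3) := by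
  classical
  obtain ⟨hϖ0, hϖ1⟩ := ne_zero_and_v_lt_one_of_v_eq_exp hϖ
  have hpρ : ϖ ^ ρ ≠ 0 := pow_ne_zero ρ hϖ0
  have hpr : ϖ ^ (2 * ρ + 2 * t + e) ≠ 0 := pow_ne_zero _ hϖ0
  -- the representatives and the reference lattices `V₀(g) = V(1, 1, g)`
  obtain ⟨R, hRfin, hRcard, hR1, hR2, hR3⟩ := exists_fixed_class_representatives hσ hvσ hfix hϖ hd ρ t hρ
  choose V₀ hV₀ using fun g : K => exists_gl_coe_eq_glued (1 : K) 1 g hpρ hpr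
  -- the orbits
  set Orb : K → Set (Submodule 𝒪[K] (Fin 3 → K)) := fun g => {M | ∃ u ∈ unitTorus K 3, M = mapGL (diagGLUnits u) (latt (V₀ g : Matrix (Fin 3) (Fin 3) K))}
    with hOrb
  have hlt : Valued.v ϖ ^ (ρ + 2 * t) < Valued.v ϖ ^ (2 * t) := by
    rw [pow_add, mul_comm]
    exact mul_lt_of_lt_one_right (pow_pos ((Valuation.pos_iff _).2 hϖ0) _) (pow_lt_one₀ zero_le hϖ1 (by omega))
  -- §4a: the set identity
  have hset : {M : Submodule 𝒪[K] (Fin 3 → K) | ∃ x ζ y'' : K, Valued.v x = 1 ∧ Valued.v ζ = 1 ∧ Valued.v y'' = Valued.v ϖ ^ (2 * t) ∧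
        M = latt (!![1, 0, 0; x, ϖ ^ ρ, 0; x * ζ + y'', ϖ ^ ρ * ζ, ϖ ^ (2 * ρ + 2 * t + e)] : Matrix (Fin 3) (Fin 3) K) ∧
        ∃ f : K, σ f = f ∧ Valued.v (ζ * σ y'' - σ x * f) ≤ Valued.v ϖ ^ (ρ + 2 * t)} = ⋃ g ∈ R, Orb g := by
    ext M
    simp only [Set.mem_setOf_eq, Set.mem_iUnion, hOrb]
    constructor
    · rintro ⟨x, ζ, y'', hx, hζ, hy'', rfl, hR⟩
      obtain ⟨f, hσf, hκf⟩ := (criterionR_iff_exists_fixed_kappa hσ hvσ hx hζ y'' _).1 hR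
      -- `|f| = |κ| = |ϖ|^{2t}`
      have hvκ : Valued.v (y'' / (x * ζ)) = Valued.v ϖ ^ (2 * t) := by rw [map_div₀, map_mul, hx, hζ, mul_one, div_one, hy'']
      have hvf : Valued.v f = Valued.v ϖ ^ (2 * t) := by
        have h := Valuation.map_sub_eq_of_lt_left Valued.v (hvκ ▸ hκf.trans_lt hlt : Valued.v (y'' / (x * ζ) - f) < Valued.v (y'' / (x * ζ)))
        rw [← hvκ, ← h, sub_sub_cancel]
      obtain ⟨g, hg, hfg⟩ := hR2 f hσf hvf
      have hκg : Valued.v (y'' / (x * ζ) - g) ≤ Valued.v ϖ ^ (ρ + 2 * t) := by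
        rw [show y'' / (x * ζ) - g = (y'' / (x * ζ) - f) + (f - g) by ring]
        exact Valuation.map_add_le _ hκf hfg
      obtain ⟨u, hu, hM⟩ := exists_mem_unitTorus_latt_glued_corner_eq_mapGL hϖ0 ρ (2 * t) hx hζ hy'' (hR1 g hg).2 hκg hpr (V₀ g) (hV₀ g)
      exact ⟨g, hg, u, hu, hM⟩
    · rintro ⟨g, hg, u, hu, rfl⟩
      obtain ⟨x', ζ', y₁, hx', hζ', hy₁, hκ, hM⟩ := exists_glued_of_mem_orbit u hu g (ϖ ^ ρ) (ϖ ^ (2 * ρ + 2 * t + e)) (V₀ g) (hV₀ g)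
      have hy₁' : Valued.v y₁ = Valued.v ϖ ^ (2 * t) := by rw [hy₁, (hR1 g hg).2]
      refine ⟨x', ζ', y₁, hx', hζ', hy₁', hM, ?_⟩
      exact (criterionR_iff_exists_fixed_kappa hσ hvσ hx' hζ' y₁ _).2 ⟨g, (hR1 g hg).1, by rw [hκ, sub_self, map_zero]; exact zero_le⟩
  -- §4b: pairwise disjoint (the class of `κ` modulo `𝔭^{ρ+2t}` separates the representatives)
  have hdisj : R.PairwiseDisjoint Orb := by
    intro g hg g' hg' hne
    rw [Function.onFun, Set.disjoint_left]
    intro M hM hM'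
    apply hne
    simp only [hOrb, Set.mem_setOf_eq] at hM hM'
    obtain ⟨u, hu, rfl⟩ := hM
    obtain ⟨u', hu', hMM⟩ := hM'
    obtain ⟨x, ζ, y, hx, hζ, hy, hκ, h1⟩ := exists_glued_of_mem_orbit u hu g (ϖ ^ ρ) (ϖ ^ (2 * ρ + 2 * t + e)) (V₀ g) (hV₀ g)
    obtain ⟨x', ζ', y', hx', hζ', hy', hκ', h2⟩ := exists_glued_of_mem_orbit u' hu' g' (ϖ ^ ρ) (ϖ ^ (2 * ρ + 2 * t + e)) (V₀ g') (hV₀ g')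
    have hyv : Valued.v y = Valued.v ϖ ^ (2 * t) := by rw [hy, (hR1 g hg).2]
    have heq := h1.symm.trans (hMM.trans h2)
    have hv := v_kappa_sub_le_of_latt_glued_corner_eq hϖ0 hϖ1.le ρ (2 * t) e hx hζ hyv hx' hζ' heq
    rw [hκ, hκ'] at hv
    exact hR3 g hg g' hg' hv
  -- §4c: each orbit has the full-torus stabiliser index as its size
  have horb : ∀ g ∈ R, (Orb g).ncard =
      ((Nat.card 𝓀[K] - 1) * Nat.card 𝓀[K] ^ (ρ + 2 * t + e - 1)) * ((Nat.card 𝓀[K] - 1) * Nat.card 𝓀[K] ^ (2 * ρ + e - 1)) := by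
    intro g hg
    have h11 : Valued.v (1 : K) = 1 := map_one _
    exact ncard_unitTorus_orbit_latt_glued_corner_eq hϖ hρ (2 * t) e h11 h11 (by rw [(hR1 g hg).2]) (V₀ g) (by rw [hV₀ g])
  -- count
  have hq : 1 < Nat.card 𝓀[K] := Finite.one_lt_card
  have hN0 : ((Nat.card 𝓀[K] - 1) * Nat.card 𝓀[K] ^ (ρ + 2 * t + e - 1)) * ((Nat.card 𝓀[K] - 1) * Nat.card 𝓀[K] ^ (2 * ρ + e - 1)) ≠ 0 :=
    mul_ne_zero (mul_ne_zero (by omega) (pow_ne_zero _ (by omega))) (mul_ne_zero (by omega) (pow_ne_zero _ (by omega)))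
  rw [hset, hRfin.ncard_biUnion (fun g hg => Set.finite_of_ncard_ne_zero (by rw [horb g hg]; exact hN0)) hdisj,
    finsum_mem_congr rfl horb, ← mul_one (((Nat.card 𝓀[K] - 1) * _) * _), ← mul_finsum_mem' _ _ hRfin, finsum_one, hRcard]
  -- exponent bookkeeping
  obtain ⟨m, hm⟩ : ∃ m, (ρ + 1) / 2 = m + 1 := ⟨(ρ + 1) / 2 - 1, by omega⟩
  rw [hm, Nat.add_sub_cancel, show 3 * ρ + (m + 1) + 2 * t + 2 * e - 3 = (ρ + 2 * t + e - 1) + (2 * ρ + e - 1) + m by omega]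
  ring

/-- **TYPE 2** (MEMO v2.1 §T2.3, `G₁(2ρ+1, 2t)`, corner `2ρ+1+2t`; (R) = LH4-p09 (g2)'s (i)₂ criterion letters): the (R)-lattices number `(q−1)³ · q^{3ρ + (ρ+1)∕2 + 2t − 1}`.
[cite: Kottwitz1986BaseChangeUnits, §1 pp. 240–241] [cite: Serre1979, Ch. IV §2 Prop. 6] -/
theorem ncard_criterionR_glued_typeTwo_eq {σ : K →+* K} {ϖ : K} {d : ℕ} (hσ : ∀ x, σ (σ x) = x) (hvσ : ∀ a, Valued.v (σ a) = Valued.v a)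
    (hfix : ∀ x : K, σ x = x → x ≠ 0 → ∃ n : ℤ, Valued.v x = WithZero.exp (2 * n)) (hϖ : Valued.v ϖ = WithZero.exp (-1 : ℤ))
    (hd : Valued.v (ϖ - σ ϖ) = Valued.v ϖ ^ d) [Finite 𝓀[K]] (ρ t : ℕ) (hρ : 1 ≤ ρ) :
    {M : Submodule 𝒪[K] (Fin 3 → K) | ∃ x ζ y'' : K, Valued.v x = 1 ∧ Valued.v ζ = 1 ∧ Valued.v y'' = Valued.v ϖ ^ (2 * t) ∧
        M = latt (!![1, 0, 0; x, ϖ ^ ρ, 0; x * ζ + y'', ϖ ^ ρ * ζ, ϖ ^ (2 * ρ + 1 + 2 * t)] : Matrix (Fin 3) (Fin 3) K) ∧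
        ∃ f : K, σ f = f ∧ Valued.v (ζ * σ y'' - σ x * f) ≤ Valued.v ϖ ^ (ρ + 2 * t)}.ncard =
      (Nat.card 𝓀[K] - 1) ^ 3 * Nat.card 𝓀[K] ^ (3 * ρ + (ρ + 1) / 2 + 2 * t - 1) := by
  have h := ncard_criterionR_glued_corner_eq hσ hvσ hfix hϖ hd ρ t 1 hρ
  rw [show 2 * ρ + 2 * t + 1 = 2 * ρ + 1 + 2 * t by ring, show 3 * ρ + (ρ + 1) / 2 + 2 * t + 2 * 1 - 3 = 3 * ρ + (ρ + 1) / 2 + 2 * t - 1 by omega] at h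
  exact h

end Summit.HodgeConjecture.HodgeConjecture.Cruxes.H413.F0P3cDyRamDiagonalGluedBoxCountCorner

end
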